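import Literature.AnabelianGeometry.AbsoluteAnabelian.AbsTopICharacterRankWithTrivial
import Literature.AnabelianGeometry.AbsoluteAnabelian.AbsTopICharacterRankLem45iiiClosures
import Literature.AnabelianGeometry.AbsoluteAnabelian.AbsTopICharacterRankCyclotomicModel
import Literature.AnabelianGeometry.AbsoluteAnabelian.AbsTopICharacterRankSplitModel
import HarnessLib

/-!
# [AbsTopI] Lemma 4.5 (iii): the hypothesis "X is not proper" is NECESSARY for sentences 2 and 3

Proof-only companion of `AbsTopICharacterRank.lean` (S. Mochizuki, *Topics in Absolute Anabelian
Geometry I: Generalities* [MochizukiAbsTopI2012], Lemma 4.5 (iii), kurims manuscript p. 54 —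
"(iii) Suppose that `X` is not proper [cf. (i)]. Then …"; [CombGC] = [MochizukiCombGC2007] Prop. 2.4
(vii) p. 20 — "Assume that `J` is `l`-cyclotomically full, and that `G` has cusps … Then … the subset
`{0} ∪ w_l(M_{G′} ⊗ ℤ_l) ⊆ ℚ` is invariant with respect to the automorphism `λ ↦ 2 − λ`"), cell
abc-iut, block F, seat abc-iut-f-062 (FACT-LIST schemata F-0222 `Lem45iii_cuspCount`, F-0223
`Lem45iii_cycloClass`, F-0224 `Lem45iii_det`, F-0225 `RealisedWeight`; sub-DAG inputs A3 / A7 / A9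
of `AbsTopICuspidalDecompositionSub.lean`).

TIGHTNESS CERTIFICATE.  The typed predicates are schemata on input data `(χ^{cyclo}, V)`; both
printed sources restrict to curves WITH CUSPS.  At the algebraic model of the PROPER-curve shape —
`V = V(ψ)` with `ψ² = χ^{cyclo}` non-degenerate and `dim V > 0` (the pure weight-`1` module: the
shape of `H^{ab} ⊗ ℚ_l = V_l(J)` for a PROPER curve, no cyclotomic summand; the model term is
`twist 1 ψ`, no new definition) — the kernel records:
* `realisedWeight_properShape_iff` — the weights realised by `V ⊕ ℚ_l` are EXACTLY `{0, 1}`;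
* `not_realisedWeightsSymmetric_properShape` — **A7 FAILS** (`{0, 1}` is not `λ ↦ 2 − λ`-invariant):
  [CombGC] Prop. 2.4 (vii)'s hypothesis "`G` has cusps" is necessary for its typed form;
* `not_lem45iii_cycloClass_properShape` — **F-0223 FAILS**: the max/min realisers are `ψ` (weight
  `1`) and `1` (weight `0`), and `ψ · 1` is NOT power-equivalent to `χ^{cyclo}` (that would force a
  power of `χ^{cyclo}` to be trivial) — the second sentence of (iii) as typed needs "not proper";
* `cuspCountViaWeights_properShape` / `lem45iii_cuspCount_properShape_one` /
  `not_lem45iii_cuspCount_properShape_zero` — the weight count A9 and the third sentence F-0222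
  return the count `d_χ + 1 = 1` at the proper shape, NOT the proper curve's `0` cusps: the third
  sentence as typed also needs "not proper" (for `r ≥ 1` cusps `rank M^{cusp} = r − 1`, for `r = 0`
  it is `0 ≠ −1`);
* whereas `detSqQuasiCyclotomic_properShape` (A3, `m = dim V`) and `lem45iii_det_properShape`
  (F-0224: `det = ψ^{dim V}` has weight `dim V > 0`) HOLD at the proper shape ([CombGC] Prop. 2.4
  (iii) assumes only sturdiness).
Closed instance `Int2SqrtModel.properShape_all` (`G = ℤ`, `K = ℚ`, `χ^{cyclo} = 4ⁿ`, `ψ = 2ⁿ`, `V = ℚ²`).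
No new definitions.  HONEST FRAMING: refereed pre-IUT anabelian geometry (linear algebra of
`G`-modules); an algebraic model refutes OUR schema at data print excludes by hypothesis — it is
consistency evidence FOR print's hypothesis, not a statement about curves; nothing here bears on
[IUTchIII] Cor. 3.12.
-/

noncomputable section

open scoped Classical

namespace Literature.AnabelianGeometry.AbsoluteAnabelian.AbsTopI

universe u v w

section ProperShape

variable {G : Type u} [Group G] [TopologicalSpace G]
variable {K : Type v} [Field K]
variable {V : Type w} [AddCommGroup V] [Module K V]
variable {χcyclo ψ : G →* Kˣ}

/-! ### `τ` of the proper shape `V(ψ)` and of its twists -/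

/-- `τ(V(ψ)(θ)) = dim V` if `ψθ` is trivial on an open subgroup of finite index, else `0`.
[cite: MochizukiAbsTopI2012, Lemma 4.5 (ii) p.54] -/
theorem quasiTrivialRank_properShape_twist [FiniteDimensional K V] (θ : G →* Kˣ) :
    quasiTrivialRank (twist (twist (1 : G →* (V ≃ₗ[K] V)) ψ) θ) =
      if ∃ U : Subgroup G, IsOpen (U : Set G) ∧ U.FiniteIndex ∧ ∀ g ∈ U, (ψ * θ) g = 1
      then Module.finrank K V else 0 := by
  rw [twist_twist_one, quasiTrivialRank_twist_one_smul]

/-- `τ(V(ψ)) = 0`: the weight-`1` module has no weight-`0` part (`ψ` is nowhere locally trivial).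
[cite: MochizukiAbsTopI2012, Lemma 4.5 (ii) p.54] -/
theorem quasiTrivialRank_properShape [FiniteDimensional K V] (hψ : ∀ g : G, ψ g ^ 2 = χcyclo g)
    (hcyc : ∀ U : Subgroup G, IsOpen (U : Set G) → U.FiniteIndex →
      ∀ a : ℤ, a ≠ 0 → ∃ g ∈ U, χcyclo g ^ a ≠ 1) :
    quasiTrivialRank (twist (1 : G →* (V ≃ₗ[K] V)) ψ) = 0 := by
  rw [quasiTrivialRank_twist_one_smul, if_neg (not_trivialOn_sqrt hψ hcyc)]

/-- `τ(V(ψ)((χ^{cyclo})⁻¹)) = 0`: no weight-`2` part either. [cite: MochizukiAbsTopI2012, Lemma 4.5 (ii) p.54] -/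
theorem quasiTrivialRank_properShape_twist_inv [FiniteDimensional K V]
    (hψ : ∀ g : G, ψ g ^ 2 = χcyclo g)
    (hcyc : ∀ U : Subgroup G, IsOpen (U : Set G) → U.FiniteIndex →
      ∀ a : ℤ, a ≠ 0 → ∃ g ∈ U, χcyclo g ^ a ≠ 1) :
    quasiTrivialRank (twist (twist (1 : G →* (V ≃ₗ[K] V)) ψ) χcyclo⁻¹) = 0 := by
  rw [quasiTrivialRank_properShape_twist, if_neg (not_trivialOn_sqrt_mul_inv hψ hcyc)]

/-! ### F-0225 at the proper shape: realised weights EXACTLY `{0, 1}`; A7 FAILS -/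

/-- **The weights realised by `V(ψ) ⊕ ℚ_l` are exactly `0` and `1`** (`ψ² = χ^{cyclo}` non-degenerate,
`dim V > 0`): print's "`{0} ∪ w_l(M)`" with `w_l(M) = {1}` — the proper-curve shape.
[cite: MochizukiAbsTopI2012, Lemma 4.5 (iii) p.54] [cite: MochizukiCombGC2007, Prop. 2.4 (vii) p.20] -/
theorem realisedWeight_properShape_iff [FiniteDimensional K V] (hψ : ∀ g : G, ψ g ^ 2 = χcyclo g)
    (hcyc : ∀ U : Subgroup G, IsOpen (U : Set G) → U.FiniteIndex →
      ∀ a : ℤ, a ≠ 0 → ∃ g ∈ U, χcyclo g ^ a ≠ 1)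
    (hd : 0 < Module.finrank K V) (w : ℚ) :
    RealisedWeight χcyclo (twist (1 : G →* (V ≃ₗ[K] V)) ψ) w ↔ w = 0 ∨ w = 1 := by
  rw [realisedWeight_iff_zero_or χcyclo hcyc]
  refine or_congr_right ?_
  constructor
  · rintro ⟨θ, hθ, hne⟩
    rw [quasiTrivialRank_properShape_twist] at hne
    by_cases h1 : ∃ U : Subgroup G, IsOpen (U : Set G) ∧ U.FiniteIndex ∧ ∀ g ∈ U, (ψ * θ⁻¹) g = 1
    · exact weight_eq_one_of_trivialOn_sqrt_mul_inv hψ hcyc hθ h1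
    · rw [if_neg h1] at hne
      exact absurd rfl hne
  · rintro rfl
    refine ⟨ψ, isQCyclotomicOfWeightK_sqrt_one hψ, ?_⟩
    rw [quasiTrivialRank_properShape_twist,
      if_pos ⟨⊤, isOpen_univ, inferInstance, fun g _ => by simp⟩]
    exact hd.ne'

/-- **A7 FAILS at the proper shape**: `{0, 1}` is not invariant under `λ ↦ 2 − λ` (`0` is realised,
`2` is not) — [CombGC] Prop. 2.4 (vii)'s hypothesis "`G` has cusps" is necessary for its typed
transcription `RealisedWeightsSymmetric`. [cite: MochizukiCombGC2007, Prop. 2.4 (vii) p.20]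
[cite: MochizukiAbsTopI2012, Lemma 4.5 (iii) p.54] -/
theorem not_realisedWeightsSymmetric_properShape [FiniteDimensional K V]
    (hψ : ∀ g : G, ψ g ^ 2 = χcyclo g)
    (hcyc : ∀ U : Subgroup G, IsOpen (U : Set G) → U.FiniteIndex →
      ∀ a : ℤ, a ≠ 0 → ∃ g ∈ U, χcyclo g ^ a ≠ 1)
    (hd : 0 < Module.finrank K V) :
    ¬ RealisedWeightsSymmetric χcyclo (twist (1 : G →* (V ≃ₗ[K] V)) ψ) := by
  rintro ⟨-, hsymm⟩
  have h0 : RealisedWeight χcyclo (twist (1 : G →* (V ≃ₗ[K] V)) ψ) 0 :=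
    (realisedWeight_properShape_iff hψ hcyc hd 0).2 (Or.inl rfl)
  have h2 := (realisedWeight_properShape_iff hψ hcyc hd (2 - 0)).1 ((hsymm 0).1 h0)
  norm_num at h2

/-! ### F-0223 FAILS at the proper shape -/

/-- **F-0223 FAILS at the proper shape** ([AbsTopI] Lemma 4.5 (iii), second sentence, as typed):
the realised weights `{0, 1}` have max `1` (realised by `ψ`) and min `0` (realised by `1`), but
`ψ · 1` is NOT power-equivalent to `χ^{cyclo}`: `(χ^{cyclo})ⁿ = ψⁿ` with `ψ² = χ^{cyclo}` forces
`ψⁿ = 1`, hence `(χ^{cyclo})ⁿ = 1` on all of `G`, contradicting non-degeneracy.  So print's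
hypothesis "`X` is not proper" is necessary for the typed second sentence.
[cite: MochizukiAbsTopI2012, Lemma 4.5 (iii) p.54] -/
theorem not_lem45iii_cycloClass_properShape [FiniteDimensional K V]
    (hψ : ∀ g : G, ψ g ^ 2 = χcyclo g)
    (hcyc : ∀ U : Subgroup G, IsOpen (U : Set G) → U.FiniteIndex →
      ∀ a : ℤ, a ≠ 0 → ∃ g ∈ U, χcyclo g ^ a ≠ 1)
    (hd : 0 < Module.finrank K V) :
    ¬ Lem45iii_cycloClass χcyclo (twist (1 : G →* (V ≃ₗ[K] V)) ψ) := by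
  rintro ⟨wmax, wmin, hmax, hmin, hprod⟩
  -- the realised weights are `{0, 1}`: `wmax = 1`, `wmin = 0`
  have hS : ∀ w, w ∈ {w : ℚ | RealisedWeight χcyclo (twist (1 : G →* (V ≃ₗ[K] V)) ψ) w} ↔
      w = 0 ∨ w = 1 := fun w => realisedWeight_properShape_iff hψ hcyc hd w
  have hwmax : wmax = 1 := by
    apply le_antisymm
    · rcases (hS wmax).1 hmax.1 with h | h
      · rw [h]; norm_num
      · rw [h]
    · exact hmax.2 ((hS 1).2 (Or.inr rfl))
  have hwmin : wmin = 0 := by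
    apply le_antisymm
    · exact hmin.2 ((hS 0).2 (Or.inl rfl))
    · rcases (hS wmin).1 hmin.1 with h | h
      · rw [h]
      · rw [h]; norm_num
  subst hwmax hwmin
  -- realisers: `ψ` of the maximum, `1` of the minimum
  have hup : quasiTrivialRank (twist (withTrivial (twist (1 : G →* (V ≃ₗ[K] V)) ψ)) ψ⁻¹) ≠ 0 := by
    rw [quasiTrivialRank_twist_withTrivial, quasiTrivialRank_properShape_twist,
      if_pos ⟨⊤, isOpen_univ, inferInstance, fun g _ => by simp⟩]
    omega
  have hlow : quasiTrivialRank (twist (withTrivial (twist (1 : G →* (V ≃ₗ[K] V)) ψ))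
      (1 : G →* Kˣ)⁻¹) ≠ 0 := by
    have hinv : (1 : G →* Kˣ)⁻¹ = 1 := by ext g; simp
    rw [hinv, quasiTrivialRank_twist_withTrivial, quasiTrivialRank_twist_one,
      if_pos ⟨⊤, isOpen_univ, inferInstance, fun g _ => rfl⟩]
    omega
  obtain ⟨n, hn, hpow⟩ := hprod ψ 1 (isQCyclotomicOfWeightK_sqrt_one hψ) hup
    (cycloWeightTwoTrivialWeightZero_holds χcyclo).2 hlow
  -- `(χ^{cyclo})ⁿ = ψⁿ` everywhere forces `(χ^{cyclo})ⁿ = 1` everywhere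
  obtain ⟨g, -, hg⟩ := hcyc ⊤ isOpen_univ inferInstance (n : ℤ) (by exact_mod_cast hn.ne')
  apply hg
  have h1 : χcyclo g ^ n = ψ g ^ n := by simpa using hpow g
  have h2 : ψ g ^ n = 1 := by
    have h3 : (ψ g ^ n) ^ 2 = ψ g ^ n := by rw [← pow_mul, mul_comm, pow_mul, hψ g, h1]
    rwa [pow_two, mul_eq_left] at h3
  rw [zpow_natCast, h1, h2]

/-! ### A9 / F-0222 at the proper shape: the typed count is `1`, not the proper curve's `0` -/

/-- **A9 at the proper shape returns the count `1`**: `τ(V((χ^{cyclo})⁻¹)) − τ(V) + 1 = 0 − 0 + 1`.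
(For a curve WITH `r ≥ 1` cusps `rank M^{cusp} = r − 1`; a proper curve has `r = 0`, not `1` —
[CombGC] Cor. 2.7 (i)'s count presupposes cusps.) [cite: MochizukiCombGC2007, Cor. 2.7 (i) proof p.23]
[cite: MochizukiAbsTopI2012, Lemma 4.5 (iii) p.54] -/
theorem cuspCountViaWeights_properShape [FiniteDimensional K V] (hψ : ∀ g : G, ψ g ^ 2 = χcyclo g)
    (hcyc : ∀ U : Subgroup G, IsOpen (U : Set G) → U.FiniteIndex →
      ∀ a : ℤ, a ≠ 0 → ∃ g ∈ U, χcyclo g ^ a ≠ 1) :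
    CuspCountViaWeights χcyclo (twist (1 : G →* (V ≃ₗ[K] V)) ψ) 1 := by
  unfold CuspCountViaWeights
  rw [quasiTrivialRank_properShape_twist_inv hψ hcyc, quasiTrivialRank_properShape hψ hcyc]
  norm_num

/-- **F-0222 at the proper shape asserts ONE cusp** (`d_χ(V) + 1 = 1` via A9 ∧ A10).
[cite: MochizukiAbsTopI2012, Lemma 4.5 (iii) p.54] -/
theorem lem45iii_cuspCount_properShape_one [FiniteDimensional K V]
    (hψ : ∀ g : G, ψ g ^ 2 = χcyclo g)
    (hcyc : ∀ U : Subgroup G, IsOpen (U : Set G) → U.FiniteIndex →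
      ∀ a : ℤ, a ≠ 0 → ∃ g ∈ U, χcyclo g ^ a ≠ 1) :
    Lem45iii_cuspCount χcyclo (twist (1 : G →* (V ≃ₗ[K] V)) ψ) 1 :=
  cuspCountOfWeights_holds χcyclo _ _ (cuspCountViaWeights_properShape hψ hcyc) (dualRankEq_holds _)

/-- **… and NOT zero cusps** — the proper curve's actual count: the third sentence of (iii) as typed
needs print's hypothesis "`X` is not proper". [cite: MochizukiAbsTopI2012, Lemma 4.5 (iii) p.54] -/
theorem not_lem45iii_cuspCount_properShape_zero [FiniteDimensional K V]
    (hψ : ∀ g : G, ψ g ^ 2 = χcyclo g)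
    (hcyc : ∀ U : Subgroup G, IsOpen (U : Set G) → U.FiniteIndex →
      ∀ a : ℤ, a ≠ 0 → ∃ g ∈ U, χcyclo g ^ a ≠ 1) :
    ¬ Lem45iii_cuspCount χcyclo (twist (1 : G →* (V ≃ₗ[K] V)) ψ) 0 := fun h =>
  one_ne_zero (lem45iii_cuspCount_unique (lem45iii_cuspCount_properShape_one hψ hcyc) h)

/-! ### A3 and F-0224 HOLD at the proper shape -/

/-- **A3 HOLDS at the proper shape** ([CombGC] Prop. 2.4 (iii), which assumes only sturdiness):
`det² = ψ^{2·dim V} = (χ^{cyclo})^{dim V}`, `0 < dim V ≤ 2·dim V`.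
[cite: MochizukiCombGC2007, Prop. 2.4 (iii) p.19] [cite: MochizukiAbsTopI2012, Lemma 4.5 (iii) p.54] -/
theorem detSqQuasiCyclotomic_properShape [FiniteDimensional K V] (hψ : ∀ g : G, ψ g ^ 2 = χcyclo g)
    (hd : 0 < Module.finrank K V) :
    DetSqQuasiCyclotomic χcyclo (twist (1 : G →* (V ≃ₗ[K] V)) ψ) := by
  refine ⟨Module.finrank K V, hd, by omega, ⊤, isOpen_univ, inferInstance, fun g _ => ?_⟩
  rw [detChar_twist_one, ← pow_mul, mul_comm, pow_mul, hψ g]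

/-- **F-0224 HOLDS at the proper shape**: `det = ψ^{dim V}` is `ℚ`-cyclotomic of positive weight
(`dim V`), via A3 ⇒ A4. [cite: MochizukiAbsTopI2012, Lemma 4.5 (iii) p.54] -/
theorem lem45iii_det_properShape [FiniteDimensional K V] (hψ : ∀ g : G, ψ g ^ 2 = χcyclo g)
    (hd : 0 < Module.finrank K V) : Lem45iii_det χcyclo (twist (1 : G →* (V ≃ₗ[K] V)) ψ) :=
  detQCyclotomicOfDetSq_holds χcyclo _ (detSqQuasiCyclotomic_properShape hψ hd)

end ProperShape

/-! ### A closed instance: `G = ℤ`, `K = ℚ`, `χ^{cyclo} = 4ⁿ`, `ψ = 2ⁿ`, `V = ℚ²` (proper shape) -/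

namespace Int2SqrtModel

/-- **The proper-curve shape at CLOSED data** (`G = ℤ` written multiplicatively, `K = ℚ`,
`χ^{cyclo}(n) = 4ⁿ`, `ψ(n) = 2ⁿ`, `V = ℚ²(ψ)` — the shape of `V_l(E)` for an elliptic curve with NO
puncture): realised weights exactly `{0, 1}`, A7 and F-0223 FAIL, F-0222 asserts `1 ≠ 0` cusps,
while A3 and F-0224 hold.  Consistency evidence for print's hypothesis "not proper"; not a curve.
[cite: MochizukiAbsTopI2012, Lemma 4.5 (iii) p.54] [cite: MochizukiCombGC2007, Prop. 2.4 (vii) p.20] -/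
theorem properShape_all :
    (∀ w : ℚ, RealisedWeight (zpowersHom ℚˣ (Units.mk0 (4 : ℚ) (by positivity)))
        (twist (1 : Multiplicative ℤ →* ((Fin 2 → ℚ) ≃ₗ[ℚ] (Fin 2 → ℚ)))
          (zpowersHom ℚˣ (Units.mk0 (2 : ℚ) (by positivity)))) w ↔ w = 0 ∨ w = 1) ∧
      ¬ RealisedWeightsSymmetric (zpowersHom ℚˣ (Units.mk0 (4 : ℚ) (by positivity)))
        (twist (1 : Multiplicative ℤ →* ((Fin 2 → ℚ) ≃ₗ[ℚ] (Fin 2 → ℚ)))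
          (zpowersHom ℚˣ (Units.mk0 (2 : ℚ) (by positivity)))) ∧
      ¬ Lem45iii_cycloClass (zpowersHom ℚˣ (Units.mk0 (4 : ℚ) (by positivity)))
        (twist (1 : Multiplicative ℤ →* ((Fin 2 → ℚ) ≃ₗ[ℚ] (Fin 2 → ℚ)))
          (zpowersHom ℚˣ (Units.mk0 (2 : ℚ) (by positivity)))) ∧
      Lem45iii_cuspCount (zpowersHom ℚˣ (Units.mk0 (4 : ℚ) (by positivity)))
        (twist (1 : Multiplicative ℤ →* ((Fin 2 → ℚ) ≃ₗ[ℚ] (Fin 2 → ℚ)))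
          (zpowersHom ℚˣ (Units.mk0 (2 : ℚ) (by positivity)))) 1 ∧
      ¬ Lem45iii_cuspCount (zpowersHom ℚˣ (Units.mk0 (4 : ℚ) (by positivity)))
        (twist (1 : Multiplicative ℤ →* ((Fin 2 → ℚ) ≃ₗ[ℚ] (Fin 2 → ℚ)))
          (zpowersHom ℚˣ (Units.mk0 (2 : ℚ) (by positivity)))) 0 ∧
      DetSqQuasiCyclotomic (zpowersHom ℚˣ (Units.mk0 (4 : ℚ) (by positivity)))
        (twist (1 : Multiplicative ℤ →* ((Fin 2 → ℚ) ≃ₗ[ℚ] (Fin 2 → ℚ)))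
          (zpowersHom ℚˣ (Units.mk0 (2 : ℚ) (by positivity)))) ∧
      Lem45iii_det (zpowersHom ℚˣ (Units.mk0 (4 : ℚ) (by positivity)))
        (twist (1 : Multiplicative ℤ →* ((Fin 2 → ℚ) ≃ₗ[ℚ] (Fin 2 → ℚ)))
          (zpowersHom ℚˣ (Units.mk0 (2 : ℚ) (by positivity)))) := by
  have hd : 0 < Module.finrank ℚ (Fin 2 → ℚ) := by simp
  have hcyc := nondegenerate_zpowersHom (x := (4 : ℚ)) (by norm_num)
  exact ⟨realisedWeight_properShape_iff Int42Model.psi_sq hcyc hd,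
    not_realisedWeightsSymmetric_properShape Int42Model.psi_sq hcyc hd,
    not_lem45iii_cycloClass_properShape Int42Model.psi_sq hcyc hd,
    lem45iii_cuspCount_properShape_one Int42Model.psi_sq hcyc,
    not_lem45iii_cuspCount_properShape_zero Int42Model.psi_sq hcyc,
    detSqQuasiCyclotomic_properShape Int42Model.psi_sq hd,
    lem45iii_det_properShape Int42Model.psi_sq hd⟩

end Int2SqrtModel

/-- **F-0223 is a genuine schema with a kernel-exhibited FAILURE at non-junk data**: some
`(G, K, V, χ^{cyclo}, ρV)` with `χ^{cyclo}` NON-DEGENERATE and `V ≠ 0` violate `Lem45iii_cycloClass`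
(the proper-curve shape) — complementing `exists_lem45iii_cycloClass` (it HOLDS at the genus-`0`
cyclotomic model) and `not_forall_lem45iii_cycloClass` (junk data, trivial `χ^{cyclo}`).
[cite: MochizukiAbsTopI2012, Lemma 4.5 (iii) p.54] -/
theorem exists_nondegenerate_not_lem45iii_cycloClass :
    ∃ (G : Type) (_ : Group G) (_ : TopologicalSpace G) (K : Type) (_ : Field K) (V : Type)
      (_ : AddCommGroup V) (_ : Module K V) (χcyclo : G →* Kˣ) (ρV : G →* (V ≃ₗ[K] V)),
      (∀ U : Subgroup G, IsOpen (U : Set G) → U.FiniteIndex →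
        ∀ a : ℤ, a ≠ 0 → ∃ g ∈ U, χcyclo g ^ a ≠ 1) ∧
      Nontrivial V ∧ ¬ Lem45iii_cycloClass χcyclo ρV :=
  ⟨Multiplicative ℤ, inferInstance, inferInstance, ℚ, inferInstance, Fin 2 → ℚ, inferInstance,
    inferInstance, _, _, nondegenerate_zpowersHom (x := (4 : ℚ)) (by norm_num), inferInstance,
    Int2SqrtModel.properShape_all.2.2.1⟩

end Literature.AnabelianGeometry.AbsoluteAnabelian.AbsTopI

end
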